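import Literature.NumberTheory.LFunctions.WeilTwoPrimeOddMarginHBase
import Literature.NumberTheory.LFunctions.WeilTwoPrimeOddMarginHDataP22
import Literature.NumberTheory.LFunctions.WeilBlockRowsP
import HarnessLib

/-!
# Two-prime odd-margin certificate H: the materialized block agrees with `P_r`, rows 30–39

`WeilCert.checkPmRow` (row `k` of the claim `Pm_{kl} = P_r(2k+1, 2l+1)`) for certificate H, by `decide +kernel`. Pure proof file; nothing is asserted.
-/

noncomputable section

namespace Literature.NumberTheory.LFunctions

set_option maxHeartbeats 0 in
/-- Row 30 of the materialized block is row 30 of `P_r` (certificate H). [folklore] -/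
theorem checkPmRow1_30_weilCert23H : weilCert23HBase.checkPmRow weilCert23HNu weilCert23HPm 1 30 = true := by
  decide +kernel

set_option maxHeartbeats 0 in
/-- Row 31 of the materialized block is row 31 of `P_r` (certificate H). [folklore] -/
theorem checkPmRow1_31_weilCert23H : weilCert23HBase.checkPmRow weilCert23HNu weilCert23HPm 1 31 = true := by
  decide +kernel

set_option maxHeartbeats 0 in
/-- Row 32 of the materialized block is row 32 of `P_r` (certificate H). [folklore] -/
theorem checkPmRow1_32_weilCert23H : weilCert23HBase.checkPmRow weilCert23HNu weilCert23HPm 1 32 = true := by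
  decide +kernel

set_option maxHeartbeats 0 in
/-- Row 33 of the materialized block is row 33 of `P_r` (certificate H). [folklore] -/
theorem checkPmRow1_33_weilCert23H : weilCert23HBase.checkPmRow weilCert23HNu weilCert23HPm 1 33 = true := by
  decide +kernel

set_option maxHeartbeats 0 in
/-- Row 34 of the materialized block is row 34 of `P_r` (certificate H). [folklore] -/
theorem checkPmRow1_34_weilCert23H : weilCert23HBase.checkPmRow weilCert23HNu weilCert23HPm 1 34 = true := by
  decide +kernel

set_option maxHeartbeats 0 in
/-- Row 35 of the materialized block is row 35 of `P_r` (certificate H). [folklore] -/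
theorem checkPmRow1_35_weilCert23H : weilCert23HBase.checkPmRow weilCert23HNu weilCert23HPm 1 35 = true := by
  decide +kernel

set_option maxHeartbeats 0 in
/-- Row 36 of the materialized block is row 36 of `P_r` (certificate H). [folklore] -/
theorem checkPmRow1_36_weilCert23H : weilCert23HBase.checkPmRow weilCert23HNu weilCert23HPm 1 36 = true := by
  decide +kernel

set_option maxHeartbeats 0 in
/-- Row 37 of the materialized block is row 37 of `P_r` (certificate H). [folklore] -/
theorem checkPmRow1_37_weilCert23H : weilCert23HBase.checkPmRow weilCert23HNu weilCert23HPm 1 37 = true := by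
  decide +kernel

set_option maxHeartbeats 0 in
/-- Row 38 of the materialized block is row 38 of `P_r` (certificate H). [folklore] -/
theorem checkPmRow1_38_weilCert23H : weilCert23HBase.checkPmRow weilCert23HNu weilCert23HPm 1 38 = true := by
  decide +kernel

set_option maxHeartbeats 0 in
/-- Row 39 of the materialized block is row 39 of `P_r` (certificate H). [folklore] -/
theorem checkPmRow1_39_weilCert23H : weilCert23HBase.checkPmRow weilCert23HNu weilCert23HPm 1 39 = true := by
  decide +kernel


end Literature.NumberTheory.LFunctions
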